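import Summits.Ventures.PercRepro.MSRMStarUniv
import Summits.Ventures.PercRepro.ExcessOneSingleton

/-!
# CONJECTURE (SING): every element of a residue instance is a singleton or a co-singleton member

Dossier proofs/MINE1-theoremS.md, Addendum 65 (Consequences); ROW C-038 of the cell. In a residue
instance `(F, u)` Conjecture V (`conjV_residue`, MSRMStarUniv.lean) gives `D(F) = F ∪ {∅}` or
`D(F) = F* ∪ {∅}`, and Theorem (SD) (`singleton_mem_diffs_of_card_diffs_le`,
ExcessOneSingleton.lean) puts the singleton `{r}` of every twin-free element with full support and
empty core among the differences; so `{r} ∈ F` in the first case and `univ ∖ r ∈ F` in the second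
(`sing_of_residue`).
-/

namespace PercRepro.MSTight

open Finset
open scoped FinsetFamily

variable {α : Type*} [DecidableEq α] [Fintype α]

/-- **CONJECTURE (SING)** (ROW C-038): in a residue instance every element `r` has `{r} ∈ F` or
`univ ∖ r ∈ F`. -/
theorem sing_of_residue {F : Finset (Finset α)} {u : Finset α} (h : Residue F u) (r : α) :
    ({r} : Finset α) ∈ F ∨ univ.erase r ∈ F := by
  have htw : ∀ b, Twin F r b → b = r := fun b hb => (h.htf r b hb).symm
  have hSD := singleton_mem_diffs_of_card_diffs_le (le_of_eq h.hexc) htw (h.hsupp r) (h.hcore r)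
  rcases conjV_residue h with hD | hD
  · left
    rw [hD, mem_insert] at hSD
    rcases hSD with h0 | h0
    · exact absurd h0 (singleton_ne_empty r)
    · exact h0
  · right
    rw [hD, mem_insert] at hSD
    rcases hSD with h0 | h0
    · exact absurd h0 (singleton_ne_empty r)
    · rw [mem_compls, compl_singleton_eq] at h0
      exact h0

end PercRepro.MSTight
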